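import Summits.FinalStateConjecture.FinalStateConjecture.Theses.MergerLatticeBudget
import Literature.Geometry.Lorentzian.SoundNearKerrLeaf
import Literature.Geometry.Lorentzian.LocatedLeaf
import Literature.Geometry.Lorentzian.VisibleIncompleteNullRay
import HarnessLib.Audit

/-!
# Strategist sketch — typed signatures for STRATEGY-CENSUS.md (crux `QuietLeaves`, stmt-10910)

`## Strengthen`: two inductive strengthenings S⁺ of the recurrence content (census-free form =
`Registered.stub_soundRecurrence` of `Lines/birth.lean`), with the routine inductions proved, so the
census can point at the exact step that carries the whole difficulty.
`## Decomposition`: the causal-sector cut (horizonless / black-hole developments) with its glue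
proved into the crux BY NAME through `Birth.QuietLeaves_of`-style projection.
Nothing here is registered as a line (see STRATEGY-CENSUS.md for why); nothing is asserted.
-/

noncomputable section

open scoped Manifold ContDiff Topology ENNReal
open Filter Set TopologicalSpace Literature.Geometry.Lorentzian

namespace Summit.FinalStateConjecture.FinalStateConjecture.Cruxes.QuietLeaves.Strategist

set_option linter.unusedVariables false
set_option linter.dupNamespace false

section Defs

variable {X : Type} [TopologicalSpace X] [ChartedSpace E3 X] [IsManifold (𝓡 3) ∞ X]
  [ConnectedSpace X] {D : InitialDataSet (𝓡 3) X}

/-- A sound `(ε,k)`-leaf of `𝒟` beyond `J⁻(K)` with SOME census. -/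
def SoundLeafBeyond (𝒟 : CauchyDevelopment D) (k : ℕ) (ε : ℝ≥0∞) (K : Set 𝒟.carrier) : Prop :=
  ∃ (N : ℕ) (M a : Fin N → ℝ) (S : Set 𝒟.carrier),
    Disjoint S (𝒟.metric.causalPast 𝒟.timeOrientation K) ∧ 𝒟.IsSoundNearKerrLeaf k ε N M a S

/-- A sound `(ε,k)`-leaf beyond `J⁻(K)` with census in the window `(N₀, m₀)`. -/
def WindowedSoundLeafBeyond (𝒟 : CauchyDevelopment D) (N₀ : ℕ) (m₀ : ℝ) (k : ℕ) (ε : ℝ≥0∞)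
    (K : Set 𝒟.carrier) : Prop :=
  ∃ (N : ℕ) (M a : Fin N → ℝ) (S : Set 𝒟.carrier), N ≤ N₀ ∧ (∀ i, m₀ ≤ M i ∧ M i ≤ m₀⁻¹) ∧
    Disjoint S (𝒟.metric.causalPast 𝒟.timeOrientation K) ∧ 𝒟.IsSoundNearKerrLeaf k ε N M a S

theorem SoundLeafBeyond.mono {𝒟 : CauchyDevelopment D} {k k' : ℕ} {ε ε' : ℝ≥0∞}
    {K : Set 𝒟.carrier} (h : SoundLeafBeyond 𝒟 k' ε K) (hk : k ≤ k') (hε : ε ≤ ε') :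
    SoundLeafBeyond 𝒟 k ε' K := by
  obtain ⟨N, M, a, S, hd, hl⟩ := h
  exact ⟨N, M, a, S, hd, hl.mono hk hε⟩

end Defs

/-- Registered signature of `stub_soundRecurrence` of `Lines/birth.lean` (verbatim copy; the crux
workfile is not a built module, so it is restated here rather than imported). -/
abbrev StubSoundRecurrence : Prop :=
  ∀ (X : Type) [TopologicalSpace X] [ChartedSpace E3 X] [IsManifold (𝓡 3) ∞ X] [T2Space X]
    [SecondCountableTopology X] [ConnectedSpace X] (D : InitialDataSet (𝓡 3) X),
    D ∈ admissibleVacuumData X → ∀ 𝒟 : VacuumCauchyDevelopment D, 𝒟.IsMaximal →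
    Summit.FinalStateConjecture.HasCompleteNullInfinity 𝒟.toCauchyDevelopment →
    ∀ (k : ℕ) (ε : ℝ≥0∞), 0 < ε → ∀ K : Set 𝒟.carrier, IsCompact K →
      ∃ (N : ℕ) (M a : Fin N → ℝ) (S : Set 𝒟.carrier),
        Disjoint S (𝒟.metric.causalPast 𝒟.timeOrientation K) ∧
        𝒟.toCauchyDevelopment.IsSoundNearKerrLeaf k ε N M a S

/-! ## Strengthen (1): induction on the derivative order `k`

S⁺ₖ := base "C⁰-quiet sound leaves at every tolerance beyond every compact set" + step "Cᵏ-quiet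
beyond every compact set ⇒ Cᵏ⁺¹-quiet beyond every compact set (same tolerance)".  The routine
induction below recovers the census-free recurrence (`Registered.stub_soundRecurrence`).  The STEP is
exactly where the recorded rough-tail witness bites (no late-time gain of regularity for o₂/o₁ data:
EVIDENCE.md / EVIDENCE-g2.md on stmt-10910), and the BASE is the windowed no-hair core at the lowest
regularity — see STRATEGY-CENSUS.md `## Strengthen`. -/

/-- S⁺ₖ, base. -/
def OrderBase : Prop :=
  ∀ (X : Type) [TopologicalSpace X] [ChartedSpace E3 X] [IsManifold (𝓡 3) ∞ X] [T2Space X]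
    [SecondCountableTopology X] [ConnectedSpace X] (D : InitialDataSet (𝓡 3) X),
    D ∈ admissibleVacuumData X → ∀ 𝒟 : VacuumCauchyDevelopment D, 𝒟.IsMaximal →
    Summit.FinalStateConjecture.HasCompleteNullInfinity 𝒟.toCauchyDevelopment →
    ∀ (ε : ℝ≥0∞), 0 < ε → ∀ K : Set 𝒟.carrier, IsCompact K →
      SoundLeafBeyond 𝒟.toCauchyDevelopment 0 ε K

/-- S⁺ₖ, step. -/
def OrderStep : Prop :=
  ∀ (X : Type) [TopologicalSpace X] [ChartedSpace E3 X] [IsManifold (𝓡 3) ∞ X] [T2Space X]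
    [SecondCountableTopology X] [ConnectedSpace X] (D : InitialDataSet (𝓡 3) X),
    D ∈ admissibleVacuumData X → ∀ 𝒟 : VacuumCauchyDevelopment D, 𝒟.IsMaximal →
    Summit.FinalStateConjecture.HasCompleteNullInfinity 𝒟.toCauchyDevelopment →
    ∀ (k : ℕ) (ε : ℝ≥0∞), 0 < ε →
      (∀ K : Set 𝒟.carrier, IsCompact K → SoundLeafBeyond 𝒟.toCauchyDevelopment k ε K) →
      ∀ K : Set 𝒟.carrier, IsCompact K → SoundLeafBeyond 𝒟.toCauchyDevelopment (k + 1) ε K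

/-- The routine induction: S⁺ₖ ⇒ census-free sound recurrence (`Registered.stub_soundRecurrence`). -/
theorem soundRecurrence_of_order (hb : OrderBase) (hs : OrderStep) :
    StubSoundRecurrence := by
  intro X _ _ _ _ _ _ D hD 𝒟 hmax hscri k
  induction k with
  | zero => exact fun ε hε K hK ↦ hb X D hD 𝒟 hmax hscri ε hε K hK
  | succ k ih => exact fun ε hε K hK ↦ hs X D hD 𝒟 hmax hscri k ε hε (ih ε hε) K hK

/-! ## Strengthen (2): dyadic induction on the tolerance `ε`

S⁺_ε := base "ONE coarse tolerance `ε₁ < ∞` at which sound leaves of every order exist beyond every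
compact set" + step "`(ε,k)`-quiet beyond every compact ⇒ `(ε/2,k)`-quiet beyond every compact".  The
step at coarse `ε` is non-perturbative (it is the crux again); at fine `ε` it is asymptotic stability
of multi-Kerr entered at an `ε`-close leaf (the sibling crux `PinnedCapture`/`Capture` strengthened);
the base is the windowed quantitative no-hair core at tolerance `ε₁`, which no known argument makes
easier than at tolerance `ε`.  Signature only. -/

/-- S⁺_ε (signature). -/
def DyadicQuietLeaves : Prop :=
  ∀ (X : Type) [TopologicalSpace X] [ChartedSpace E3 X] [IsManifold (𝓡 3) ∞ X] [T2Space X]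
    [SecondCountableTopology X] [ConnectedSpace X] (D : InitialDataSet (𝓡 3) X),
    D ∈ admissibleVacuumData X → ∀ 𝒟 : VacuumCauchyDevelopment D, 𝒟.IsMaximal →
    Summit.FinalStateConjecture.HasCompleteNullInfinity 𝒟.toCauchyDevelopment →
    (∃ ε₁ : ℝ≥0∞, 0 < ε₁ ∧ ε₁ ≠ ⊤ ∧
      ∀ (k : ℕ) (K : Set 𝒟.carrier), IsCompact K → SoundLeafBeyond 𝒟.toCauchyDevelopment k ε₁ K) ∧
    (∀ (k : ℕ) (ε : ℝ≥0∞), 0 < ε →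
      (∀ K : Set 𝒟.carrier, IsCompact K → SoundLeafBeyond 𝒟.toCauchyDevelopment k ε K) →
      ∀ K : Set 𝒟.carrier, IsCompact K → SoundLeafBeyond 𝒟.toCauchyDevelopment k (ε / 2) K)

/-! ## Decomposition (2): the causal-sector cut

`QuietLeaves ⇐ DispersiveQuietLeaves ∧ BlackHoleQuietLeaves`, sorting complete-`𝓘⁺` developments by
whether the intrinsic black-hole region `M ∖ J⁻(𝓘⁺)` is empty (`visibleRegion = univ`, the vocabulary
of routes `BondiDrainDispersal` / `CurvatureOrSymmetry`).  Glue proved below into BOTH crux decls. -/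

/-- Sector 1: horizonless complete-`𝓘⁺` developments recur to FLAT sound leaves (`N = 0`). -/
def DispersiveQuietLeaves : Prop :=
  ∀ (X : Type) [TopologicalSpace X] [ChartedSpace E3 X] [IsManifold (𝓡 3) ∞ X] [T2Space X]
    [SecondCountableTopology X] [ConnectedSpace X] (D : InitialDataSet (𝓡 3) X),
    D ∈ admissibleVacuumData X → ∀ 𝒟 : VacuumCauchyDevelopment D, 𝒟.IsMaximal →
    Summit.FinalStateConjecture.HasCompleteNullInfinity 𝒟.toCauchyDevelopment →
    ∀ [𝒟.metric.HasLeviCivita],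
    𝒟.toCauchyDevelopment.toDataEmbedding.visibleRegion = Set.univ →
    ∀ (k : ℕ) (ε : ℝ≥0∞), 0 < ε → ∀ K : Set 𝒟.carrier, IsCompact K →
      ∃ S : Set 𝒟.carrier, Disjoint S (𝒟.metric.causalPast 𝒟.timeOrientation K) ∧
        𝒟.toCauchyDevelopment.IsSoundNearKerrLeaf k ε 0 Fin.elim0 Fin.elim0 S

/-- Sector 2: complete-`𝓘⁺` developments WITH a black-hole region recur to sound leaves with a
windowed census. -/
def BlackHoleQuietLeaves : Prop :=
  ∀ (X : Type) [TopologicalSpace X] [ChartedSpace E3 X] [IsManifold (𝓡 3) ∞ X] [T2Space X]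
    [SecondCountableTopology X] [ConnectedSpace X] (D : InitialDataSet (𝓡 3) X),
    D ∈ admissibleVacuumData X → ∀ 𝒟 : VacuumCauchyDevelopment D, 𝒟.IsMaximal →
    Summit.FinalStateConjecture.HasCompleteNullInfinity 𝒟.toCauchyDevelopment →
    ∀ [𝒟.metric.HasLeviCivita],
    𝒟.toCauchyDevelopment.toDataEmbedding.visibleRegion ≠ Set.univ →
    ∃ (N₀ : ℕ) (m₀ : ℝ), 0 < m₀ ∧ ∀ (k : ℕ) (ε : ℝ≥0∞), 0 < ε → ∀ K : Set 𝒟.carrier,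
      IsCompact K → WindowedSoundLeafBeyond 𝒟.toCauchyDevelopment N₀ m₀ k ε K

/-- Glue of the sector cut into the windowed sound recurrence (`Birth.soundQuietLeaves`' conclusion
shape), under the standing Levi-Civita hypothesis of the route's own `LeafBudgetLawsR`. -/
theorem windowedSoundRecurrence_of_sectors (h₁ : DispersiveQuietLeaves) (h₂ : BlackHoleQuietLeaves) :
  ∀ (X : Type) [TopologicalSpace X] [ChartedSpace E3 X] [IsManifold (𝓡 3) ∞ X] [T2Space X]
    [SecondCountableTopology X] [ConnectedSpace X] (D : InitialDataSet (𝓡 3) X),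
    D ∈ admissibleVacuumData X → ∀ 𝒟 : VacuumCauchyDevelopment D, 𝒟.IsMaximal →
    Summit.FinalStateConjecture.HasCompleteNullInfinity 𝒟.toCauchyDevelopment →
    ∀ [𝒟.metric.HasLeviCivita],
    ∃ (N₀ : ℕ) (m₀ : ℝ), 0 < m₀ ∧ ∀ (k : ℕ) (ε : ℝ≥0∞), 0 < ε → ∀ K : Set 𝒟.carrier,
      IsCompact K → WindowedSoundLeafBeyond 𝒟.toCauchyDevelopment N₀ m₀ k ε K := by
  intro X _ _ _ _ _ _ D hD 𝒟 hmax hscri _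
  by_cases hvis : 𝒟.toCauchyDevelopment.toDataEmbedding.visibleRegion = Set.univ
  · refine ⟨0, 1, one_pos, fun k ε hε K hK ↦ ?_⟩
    obtain ⟨S, hd, hl⟩ := h₁ X D hD 𝒟 hmax hscri hvis k ε hε K hK
    exact ⟨0, Fin.elim0, Fin.elim0, S, le_rfl, fun i ↦ i.elim0, hd, hl⟩
  · exact h₂ X D hD 𝒟 hmax hscri hvis

end Summit.FinalStateConjecture.FinalStateConjecture.Cruxes.QuietLeaves.Strategist

end
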